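import Literature.Analysis.FluidPDE.LocalLeraySolutionsSlab
import Literature.Analysis.FluidPDE.CKNMorreyLemmas
import HarnessLib

/-!
# Jia–Šverák 2014: local-in-space regularity of Leray solutions near the initial time

Analysis/FluidPDE named-fact file (D-0014) vendoring the local-in-space regularity results near
`t = 0` of H. Jia, V. Šverák, *Local-in-space estimates near initial time for weak solutions of
the Navier–Stokes equations and forward self-similar solutions*, Invent. Math. 196 (2014)
233–265 = arXiv:1204.0529, §3–§4 ("(S) Modulo the usual (and quite mild) non-local influences
of the pressure, local regularity of the initial data propagates for at least a short time",
§1), over the tree's class of local Leray solutions (`IsLocalLeraySolutionOn`,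
`IsLocalLeraySolution`; Jia–Šverák's `𝒩(u₀)`, §3 Def. 3.1, in the form of Kang–Miura–Tsai 2021
Def. 3.2 / Lemarié-Rieusset 2016 Def. 14.1):

* `jia_sverak_2014_theorem_3_2` — **Thm. 3.2 (Local Hölder regularity of Leray solutions)**
  (arXiv rendering: "Theorem 5"): "Let `u₀ ∈ L²_loc(ℝ³)` with
  `sup_{x₀∈ℝ³} ∫_{B₁(x₀)} |u₀|² dx ≤ α < ∞`. Suppose `u₀` is in `C^γ(B₂(0))` with
  `‖u₀‖_{C^γ(B₂(0))} ≤ M < ∞`. Then there exists a positive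
  `T = T(α, γ, M) > 0`, such that any Leray solution `u ∈ 𝒩(u₀)` satisfies:
  `u ∈ C^γ_par(B̄_{1/4} × [0,T])`, and `‖u‖_{C^γ_par(B̄_{1/4} × [0,T])} ≤ C(M, α, γ)`."
* `jia_sverak_2014_local_higher_regularity` — the **all-orders form for locally smooth data**.
  PRINTED SETTING: this is a claim made inside the proof of Thm. 4.1 (§4; arXiv rendering
  "Theorem 6") under the STANDING ASSUMPTIONS of §4 — "Let `u` be a Leray solution with initial
  data `u₀`. Suppose `λu₀(λx) = u₀(x)`, `λu(λx, λ²t) = u(x,t)` for any `λ > 0`. We also assume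
  `u₀|_{∂B₁(0)} ∈ C^∞(∂B₁(0))`" — i.e. for `(−1)`-homogeneous data smooth on the unit sphere, with
  `M := ‖u₀‖_{C(∂B₁)}`: "for `∀ x₀`, `|x₀| = 8`, since `u₀ ∈ C^∞(B₄(x₀))`, we can apply Theorem 3.1
  and some simple bootstrapping arguments to show the following: there exists `T₂ = T₂(M) > 0`
  such that `∀ α`, `‖∂ₜ∂ₓ^α u‖_{L^∞(B_{1/8}(x₀) × [0,T₂])} ≤ C(α, u₀)`, this is true for any
  `u ∈ 𝒩(u₀)`", and the Remark of §4: "constants `C(u₀,…), T(u₀,…)…` only depend on the magnitude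
  of `u₀` and its finitely many derivatives on the unit sphere". WHAT IS VENDORED is the
  GENERAL-DATA READING of this printed argument (a generalisation by the vendor, not a printed
  sentence — see the transcription note *General data*): arbitrary data `u₀ ∈ E²` smooth on
  `B₄(x₀)` with derivative bounds `A`, constants depending on `(α, A)`. (Thm. 3.1, arXiv
  "Theorem 4", is the `L^m`-data version, `m > 3`, for GENERAL `u₀ ∈ L²_uloc`, stated for `u − a`
  with `a` the mild solution from the localised datum; it is the input of both results and is not
  vendored separately.)

Both are NAMED FACTS (`def … : Prop`, users take `(h : …)`); the tree has none of the parabolic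
regularity theory of §2 (ε-regularity for the perturbed system (2.1), Campanato iteration) on
which the printed proofs rest. Proved here: the specialisations to Jia–Šverák's own global-in-time
class `𝒩(u₀)` (`IsLocalLeraySolution`), `jia_sverak_2014_theorem_3_2.of_isLocalLeraySolution` and
`jia_sverak_2014_local_higher_regularity.of_isLocalLeraySolution`, and the extraction of pointwise
time-derivative bounds from the Lipschitz-in-time clause for time-differentiable representatives
(`norm_le_of_hasDerivWithinAt_of_lipschitz_time`), which is how classical solutions consume the
second fact.

## Transcription notes (read before attacking the statements)

* *The class and the time slab.* Jia–Šverák define Leray solutions on `ℝ³ × (0, ∞)` (§3 Def. 3.1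
  = the tree's `IsLocalLeraySolution 1 u₀ u p`, via Kang–Miura–Tsai 2021 Def. 3.2). The proofs of
  Thm. 3.1/3.2 and of the §4 claim only ever use the solution on a short initial slab `(0, T₁)`
  (local energy estimate of Lemma 3.1 on `(0, λR²)`, the perturbed local energy inequality for
  `v = u − a` on `(0, T₂)`, extension by zero to negative times and ε-regularity on unit cylinders
  below `t₀`), so the facts are rendered over the tree's finite-slab class
  `IsLocalLeraySolutionOn T' 1 u₀ u p` (Lemarié-Rieusset 2016 Def. 14.1, any `T' > 0`) with the
  conclusion on `[0, min(T, T')]`; the printed global-class statements are the special case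
  `T' = T` (`IsLocalLeraySolution.isLocalLeraySolutionOn`), proved below. The order-zero slab form
  is also in print as such: Kang–Miura–Tsai, Partial Differ. Equ. Appl. 2 (2021), Thm. 1.2 ("Let
  `(v,p)` be a local energy solution in `ℝ³ × (0,T)` with the initial data `v₀ ∈ L²_uloc`. If
  `v₀ ∈ L^q(B₂)` for some `q ∈ (3,∞]`, then there exists
  `T₃ = T₃(q, ‖v₀‖_{L^q(B₂)}, ‖v₀‖_{L²_uloc}) > 0` such that `v` is regular in `B₁ × (0,T₃)` and
  satisfies `‖v(t)‖_{L^∞(B₁)} ≤ C(…) t^{-3/(2q)}`").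
* *Centres.* Thm. 3.2 is printed at the origin and the §4 claim at `|x₀| = 8`; the class and the
  equations are translation invariant and Jia–Šverák themselves apply Thm. 3.1 at `x₀ ≠ 0` in §4
  ("for `∀ x₀`, `|x₀| = 8` … we can apply Theorem 3.1"), so both facts quantify over the centre
  `x₀` with constants independent of it.
* *General data (the §4 claim).* In print the all-orders claim is asserted only for the
  homogeneous datum of §4 (smooth on `ℝ³ ∖ {0}`), at centres `|x₀| = 8`, with `T₂ = T₂(M)`,
  `M = ‖u₀‖_{C(∂B₁)}`, and `C(α, u₀)` depending on finitely many derivatives of `u₀` on the unit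
  sphere. The printed ARGUMENT for it is local and uses nothing homogeneous: "since
  `u₀ ∈ C^∞(B₄(x₀))`, we can apply Theorem 3.1 [stated for general `u₀ ∈ L²_uloc` with
  `u₀ ∈ L^m(B₂)`, `m > 3`, constants `T(α, m, M)`, `C(M, m, α)`] and some simple bootstrapping
  arguments" (interior parabolic bootstrapping on `B_{1/2}(x₀) × [0, T]` from the Hölder bound of
  Thm. 3.1, the smoothness of `u₀` on `B₄(x₀)` and the uniform local energy bound of Lemma 3.1);
  homogeneity enters the printed proof only afterwards ("Since `∀ λ > 0`, `λu(λx, λ²t)` is also a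
  Leray solution with initial data `u₀` …"). The fact `jia_sverak_2014_local_higher_regularity`
  is THE VENDOR'S GENERAL-DATA READING of that argument: arbitrary data `u₀ ∈ E²`, smooth on
  `B₄(x₀)` with `‖Dⁿu₀‖ ≤ A n` there, any centre `x₀`, and constants `T = T(α, A)`,
  `C n = C(n, α, A)` uniform in the datum, the centre and the solution — for the homogeneous data
  of §4 these are functions of `M` and of finitely many derivatives of `u₀` on the unit sphere
  (by homogeneity, `α ≲ M²` and the derivatives on `B₄(x₀)`, `|x₀| = 8`, are controlled by those
  on the sphere), which is the printed dependence. This generalisation is NOT a printed sentence;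
  the review of p41646 (2026-08-15) judged the reading mathematically sound ("Thm 3.1 is stated
  for general data and the sketch uses nothing homogeneous"). A consumer who wants only print
  verbatim should instantiate the fact at homogeneous data.
* *"`u ∈ C^γ_par`", "`‖∂ₜ∂ₓ^α u‖_{L^∞}`" for an a.e.-defined field.* A local Leray solution is an
  `L²_loc` field; membership in a space of continuous functions means: `u` agrees a.e. on the
  open cylinder with a representative `U` having the stated regularity. Since `U` is continuous up
  to `t = 0` and `u(t) → u₀` in `L²_loc` (Def. 3.1 (ii)), `U(0, ·) = u₀` a.e. on the ball, hence
  everywhere on it when `u₀` is continuous there (both facts assume this): the clause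
  `U 0 x = u₀ x` is therefore implied by the printed statement and is recorded explicitly.
  The parabolic Hölder norm is rendered as the sup bound plus the parabolic Hölder quotient
  `‖U(t,x) − U(s,y)‖ ≤ C (|t − s|^{1/2} + |x − y|)^γ`, the accepted `IsParabolicHolderOn`
  (`CKNMorreyLemmas.lean`, Lemarié-Rieusset 2016 p. 462; any of the equivalent parabolic metrics
  changes only `C`); `‖u₀‖_{C^γ(B₂)} ≤ M` as the sup bound `≤ M` and Mathlib's
  `HolderOnWith M γ u₀ (ball x₀ 2)` (the Hölder quotient `≤ M`). The `L^∞` bound on `∂ₜ∂ₓ^α u`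
  over the closed cylinder is rendered as: every spatial
  derivative `Dⁿ U(t, ·)` (the full `n`-th Fréchet derivative, which bounds and is bounded by the
  partials `∂ₓ^α`, `|α| = n`, up to dimensional constants) is bounded by `C n` on
  `[0, T] × B_{1/8}(x₀)` and is `C n`-Lipschitz in `t` there — for the continuous functions
  `Dⁿ U(·, x)` this is exactly `‖∂ₜ Dⁿ U‖_{L^∞} ≤ C n` (and the bound on `Dⁿ U` itself follows in
  print from the one on `∂ₜ Dⁿ U` and `Dⁿ u₀`). Deliberately NOT claimed: bounds on higher time
  derivatives or joint smoothness up to `t = 0` — the print bounds one time derivative only (the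
  harmonic far-field part of the pressure, formula (3.3) of §3, is smooth in `x` but merely
  bounded in `t` near `t = 0` for rough data away from `x₀`).
* *Constants.* Print: `T = T(α, γ, M)`, `C = C(M, α, γ)` (Thm. 3.2); `T₂ = T₂(M)`,
  `C = C(α, u₀)` depending on "the magnitude of `u₀` and its finitely many derivatives" (§4). The
  facts let `T` and `C` depend on all the displayed bounds (`α, γ, M`, resp. `α` and the whole
  sequence `A` of derivative bounds), which is weaker than print, and on nothing else (uniformity
  in the datum, the centre and the solution, as printed: "this is true for any `u ∈ 𝒩(u₀)`").
* *Data.* "`u₀ ∈ L²_loc(ℝ³)`, `div u₀ = 0`, `sup_{x₀} ∫_{B₁(x₀)} |u₀|² ≤ α`" is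
  `AEStronglyMeasurable u₀`, `IsWeaklyDivFree u₀` and the uniformly local bound with `α : ℝ≥0`;
  in addition the facts assume the decay of the datum at infinity, `∫_{B₁(y)} |u₀|² → 0` as
  `|y| → ∞` (i.e. `u₀ ∈ E²`, the standing datum class of Kang–Miura–Tsai's Def. 3.2 which the
  tree's `IsLocalLeraySolutionOn` transcribes, and the generality Jia–Šverák announce in §1:
  "under quite general assumptions, which include `u₀` which is in `L²_loc` and
  `∫_{B_{x,r}} |u₀|² dx → 0` for `x → ∞`") — an extra hypothesis relative to the sentence of
  Thm. 3.2, so the facts are at most weaker than print. Unit viscosity and no force, as printed;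
  general `ν > 0` and radii follow by the Navier–Stokes scaling (tree:
  `LocalLeraySlabViscosityScaling`, `LocalLerayRescaling`) and are left to consumers.

## Mathlib / tree search

Tree (`lean search`): `IsLocalLeraySolutionOn`, `IsLocalLeraySolution.isLocalLeraySolutionOn`
(`LocalLeraySolutionsSlab.lean`), `IsWeaklyDivFree` (`VectorCalculus.lean`); neighbouring facts
over the same class: `jia_sverak_2013_lemma_2` (= Lemma 3.1 here),
`kangMiuraTsai_local_pressure_bound`, `jiaSverak2014_slab_pressure_decomposition` (formula (3.3)),
`leray_solution_farField_bound_slab`;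
no local-regularity-near-initial-time statement (`lean search 'near.?initial|localRegularity|
LocalSmoothing'`: only `knss2009_local_smoothing`, the bounded-data mild smoothing, unrelated).
`IsParabolicHolderOn` (`CKNMorreyLemmas.lean`; the `F`-valued twin `ParabolicHolderOnWith` of
`ParabolicHeatPotentials.lean` would import the heat-potential theory and is not needed).
Mathlib: `HolderOnWith`, `iteratedFDeriv`, `ContDiffOn`, `HasDerivWithinAt`, `slope`,
`hasDerivWithinAt_iff_tendsto_slope`, `Filter.EventuallyEq` (`=ᵐ`); Mathlib has no parabolic
Hölder classes (searched `parabolic`, `Campanato`).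

## References

* H. Jia, V. Šverák, Invent. Math. 196 (2014) 233–265 = arXiv:1204.0529: §3 Def. 3.1 (Leray
  solutions `𝒩(u₀)`), Lemma 3.1 (a priori estimate, = `jia_sverak_2013_lemma_2`), **Thm. 3.1**,
  Lemma 3.2, **Thm. 3.2** and its proof; §4, **proof of Thm. 4.1** (the claim for `|x₀| = 8`) and
  the Remark on constants. Bib key `JiaSverak2014`.
* K. Kang, H. Miura, T.-P. Tsai, *Local regularity conditions on initial data for local energy
  solutions of the Navier–Stokes equations*, Partial Differ. Equ. Appl. 2 (2021) =
  arXiv:2106.03980, Thm. 1.2 and Def. 2.1 (local energy solutions on `ℝ³ × (0,T)`).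
  Bib key `KangMiuraTsai2021`.
* K. Kang, H. Miura, T.-P. Tsai, IMRN 2021 = arXiv:1812.10509, §3 Def. 3.1–3.2, Lemmas 3.3–3.4;
  Thm. 1.1 / Cor. 1.2 (the critical `L³` interior version). Bib key `KangMiuraTsai2020`.
* P. G. Lemarié-Rieusset, *The Navier–Stokes Problem in the 21st Century* (2016), Def. 14.1.
  Bib key `LemarieRieusset2016`.
-/

noncomputable section

open MeasureTheory TopologicalSpace Set Function Filter Metric
open _root_.Topology
open scoped ENNReal NNReal ContDiff

namespace Literature.Analysis.FluidPDE

local notation "ℝ³" => EuclideanSpace ℝ (Fin 3)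

/-! ### Thm. 3.2: local Hölder regularity near the initial time -/

/-- NAMED FACT (Jia–Šverák, Invent. Math. 196 (2014) = arXiv:1204.0529, §3 **Thm. 3.2** "(Local
Hölder regularity of Leray solutions)", arXiv rendering "Theorem 5"): "Let `u₀ ∈ L²_loc(ℝ³)` with
`sup_{x₀∈ℝ³} ∫_{B₁(x₀)} |u₀|²(x) dx ≤ α < ∞`. Suppose `u₀` is in `C^γ(B₂(0))` with
`‖u₀‖_{C^γ(B₂(0))} ≤ M < ∞`. Then there exists a positive `T = T(α, γ, M) > 0`, such that any Leray
solution `u ∈ 𝒩(u₀)` satisfies: `u ∈ C^γ_par(B̄_{1/4} × [0,T])`, and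
`‖u‖_{C^γ_par(B̄_{1/4} × [0,T])} ≤ C(M, α, γ)`." (`u₀` divergence free throughout the paper, §1
Notation; `𝒩(u₀)` = §3 Def. 3.1.) Rendering (module docstring, transcription notes): for all
`α : ℝ≥0`, `M` and `γ ∈ (0, 1)` there are `T > 0` and `C` such that for every measurable, weakly
divergence-free `u₀` with `∫_{B₁(y)} |u₀|² ≤ α` for all `y` and `∫_{B₁(y)} |u₀|² → 0` as `|y| → ∞`
(`u₀ ∈ E²`, §1 and Kang–Miura–Tsai Def. 3.2), every centre `x₀` with `|u₀| ≤ M` and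
`|u₀(x) − u₀(y)| ≤ M |x − y|^γ` on `B₂(x₀)` (Mathlib `HolderOnWith`), every `T' > 0` and every
local Leray solution `(u, p)` of the unit-viscosity unforced equations on `(0, T') × ℝ³` with
datum `u₀` (`IsLocalLeraySolutionOn T' 1 u₀ u p`), there is a representative `U`, `U = u` a.e.
on `(0, min(T,T')) × B_{1/4}(x₀)`, with `U(0, ·) = u₀` on `B̄_{1/4}(x₀)`, `|U| ≤ C` and
`|U(t,x) − U(s,y)| ≤ C (|t − s|^{1/2} + |x − y|)^γ` on `[0, min(T,T')] × B̄_{1/4}(x₀)` (the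
accepted `IsParabolicHolderOn`). The printed
global-class form is `jia_sverak_2014_theorem_3_2.of_isLocalLeraySolution`. Users take
`(h : jia_sverak_2014_theorem_3_2)`.
[cite: JiaSverak2014, §3 Thm. 3.2 (Local Hölder regularity of Leray solutions) with Def. 3.1] -/
def jia_sverak_2014_theorem_3_2 : Prop :=
  ∀ (α M γ : ℝ≥0), 0 < γ → γ < 1 →
    ∃ T : ℝ, 0 < T ∧ ∃ C : ℝ,
      ∀ (u₀ : ℝ³ → ℝ³) (x₀ : ℝ³) (T' : ℝ) (u : ℝ → ℝ³ → ℝ³) (p : ℝ → ℝ³ → ℝ),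
        AEStronglyMeasurable u₀ volume → IsWeaklyDivFree u₀ →
        (∀ y : ℝ³, ∫⁻ x in ball y 1, ‖u₀ x‖ₑ ^ 2 ≤ (α : ℝ≥0∞)) →
        Tendsto (fun y : ℝ³ => ∫⁻ x in ball y 1, ‖u₀ x‖ₑ ^ 2) (cocompact ℝ³) (𝓝 0) →
        (∀ x ∈ ball x₀ 2, ‖u₀ x‖ ≤ M) → HolderOnWith M γ u₀ (ball x₀ 2) →
        0 < T' → IsLocalLeraySolutionOn T' 1 u₀ u p →
        ∃ U : ℝ → ℝ³ → ℝ³,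
          uncurry U =ᵐ[volume.restrict (Ioo 0 (min T T') ×ˢ ball x₀ (1 / 4))] uncurry u ∧
          (∀ x ∈ closedBall x₀ (1 / 4), U 0 x = u₀ x) ∧
          (∀ z ∈ Icc 0 (min T T') ×ˢ closedBall x₀ (1 / 4), ‖uncurry U z‖ ≤ C) ∧
          IsParabolicHolderOn (Icc 0 (min T T') ×ˢ closedBall x₀ (1 / 4)) (uncurry U) C γ

/-- **Thm. 3.2 in Jia–Šverák's own (global-in-time) class `𝒩(u₀)`**: the printed setting, a Leray
solution on `ℝ³ × (0, ∞)` (`IsLocalLeraySolution 1 u₀ u p`), is the case `T' = T` of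
`jia_sverak_2014_theorem_3_2`, a global solution being a local Leray solution on every slab
(`IsLocalLeraySolution.isLocalLeraySolutionOn`); the conclusion is then on the printed cylinder
`[0, T] × B̄_{1/4}(x₀)`. [cite: JiaSverak2014, §3 Thm. 3.2] -/
theorem jia_sverak_2014_theorem_3_2.of_isLocalLeraySolution (h : jia_sverak_2014_theorem_3_2)
    (α M γ : ℝ≥0) (hγ : 0 < γ) (hγ1 : γ < 1) :
    ∃ T : ℝ, 0 < T ∧ ∃ C : ℝ,
      ∀ (u₀ : ℝ³ → ℝ³) (x₀ : ℝ³) (u : ℝ → ℝ³ → ℝ³) (p : ℝ → ℝ³ → ℝ),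
        AEStronglyMeasurable u₀ volume → IsWeaklyDivFree u₀ →
        (∀ y : ℝ³, ∫⁻ x in ball y 1, ‖u₀ x‖ₑ ^ 2 ≤ (α : ℝ≥0∞)) →
        Tendsto (fun y : ℝ³ => ∫⁻ x in ball y 1, ‖u₀ x‖ₑ ^ 2) (cocompact ℝ³) (𝓝 0) →
        (∀ x ∈ ball x₀ 2, ‖u₀ x‖ ≤ M) → HolderOnWith M γ u₀ (ball x₀ 2) →
        IsLocalLeraySolution 1 u₀ u p →
        ∃ U : ℝ → ℝ³ → ℝ³,
          uncurry U =ᵐ[volume.restrict (Ioo 0 T ×ˢ ball x₀ (1 / 4))] uncurry u ∧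
          (∀ x ∈ closedBall x₀ (1 / 4), U 0 x = u₀ x) ∧
          (∀ z ∈ Icc 0 T ×ˢ closedBall x₀ (1 / 4), ‖uncurry U z‖ ≤ C) ∧
          IsParabolicHolderOn (Icc 0 T ×ˢ closedBall x₀ (1 / 4)) (uncurry U) C γ := by
  obtain ⟨T, hT, C, hC⟩ := h α M γ hγ hγ1
  refine ⟨T, hT, C, fun u₀ x₀ u p hm hdiv hα hdec hM hH hu => ?_⟩
  simpa only [min_self] using
    hC u₀ x₀ T u p hm hdiv hα hdec hM hH hT (hu.isLocalLeraySolutionOn T)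

/-! ### The all-orders form for locally smooth data (proof of Thm. 4.1) -/

/-- NAMED FACT — GENERAL-DATA READING OF A PRINTED ARGUMENT (Jia–Šverák, Invent. Math. 196
(2014) = arXiv:1204.0529, §4, **proof of Thm. 4.1**, arXiv rendering "Theorem 6"). PRINTED
SETTING, the standing assumptions of §4: "Let `u` be a Leray solution with initial data `u₀`.
Suppose `λu₀(λx) = u₀(x)`, `λu(λx, λ²t) = u(x,t)` for any `λ > 0`. We also assume
`u₀|_{∂B₁(0)} ∈ C^∞(∂B₁(0))`", and in the proof of Thm. 4.1, with `M := ‖u₀‖_{C(∂B₁)}`: "for `∀ x₀`,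
`|x₀| = 8`, since `u₀ ∈ C^∞(B₄(x₀))`, we can apply Theorem 3.1 and some simple bootstrapping
arguments to show the following: there exists `T₂ = T₂(M) > 0` such that `∀ α`,
`‖∂ₜ∂ₓ^α u‖_{L^∞(B_{1/8}(x₀) × [0,T₂])} ≤ C(α, u₀)`, this is true for any `u ∈ 𝒩(u₀)`", with the
Remark of §4 "constants `C(u₀,…), T(u₀,…)…` only depend on the magnitude of `u₀` and its finitely
many derivatives on the unit sphere". So IN PRINT the claim is made for `(−1)`-homogeneous data
smooth on the sphere. WHAT IS VENDORED HERE is the general-data statement that the printed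
ARGUMENT yields — Thm. 3.1 is stated for general `u₀ ∈ L²_uloc` with local `L^m` data (`T(α,m,M)`,
`C(M,m,α)`) and the bootstrapping is local on `B_{1/2}(x₀) × [0,T]`, using only the smoothness of
`u₀` on `B₄(x₀)`; homogeneity is used in §4 only after this claim (module docstring, transcription
note *General data*; this generalisation is the vendor's reading, not a printed sentence).
Rendering (transcription notes — in particular only ONE time derivative is claimed, as printed):
for all `α : ℝ≥0` and every sequence of bounds `A : ℕ → ℝ` there are `T > 0`
and `C : ℕ → ℝ` such that for every measurable, weakly divergence-free `u₀` with
`∫_{B₁(y)} |u₀|² ≤ α` for all `y` and `∫_{B₁(y)} |u₀|² → 0` as `|y| → ∞` (`u₀ ∈ E²`), every centre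
`x₀` with `u₀ ∈ C^∞(B₄(x₀))` and
`‖Dⁿu₀‖ ≤ A n` on `B₄(x₀)` for all `n`, every `T' > 0` and every local Leray solution `(u, p)` of
the unit-viscosity unforced equations on `(0, T') × ℝ³` with datum `u₀`
(`IsLocalLeraySolutionOn T' 1 u₀ u p`), there is a representative `U`, `U = u` a.e. on
`(0, min(T,T')) × B_{1/8}(x₀)`, jointly continuous on `[0, min(T,T')] × B_{1/8}(x₀)`, with smooth
slices `U(t, ·)` on `B_{1/8}(x₀)`, `U(0, ·) = u₀` there, and for every `n`:
`‖Dⁿ U(t, x)‖ ≤ C n` and `‖Dⁿ U(t, x) − Dⁿ U(s, x)‖ ≤ C n · |t − s|` for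
`t, s ∈ [0, min(T,T')]`, `x ∈ B_{1/8}(x₀)` (i.e. `‖∂ₜ Dⁿ U‖_{L^∞} ≤ C n`). The printed global-class
form is `jia_sverak_2014_local_higher_regularity.of_isLocalLeraySolution`. Users take
`(h : jia_sverak_2014_local_higher_regularity)`.
[cite: JiaSverak2014, §4 proof of Thm. 4.1 (claim for |x₀| = 8; printed for homogeneous data) with Thm. 3.1 — general-data reading] -/
def jia_sverak_2014_local_higher_regularity : Prop :=
  ∀ (α : ℝ≥0) (A : ℕ → ℝ), ∃ T : ℝ, 0 < T ∧ ∃ C : ℕ → ℝ,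
    ∀ (u₀ : ℝ³ → ℝ³) (x₀ : ℝ³) (T' : ℝ) (u : ℝ → ℝ³ → ℝ³) (p : ℝ → ℝ³ → ℝ),
      AEStronglyMeasurable u₀ volume → IsWeaklyDivFree u₀ →
      (∀ y : ℝ³, ∫⁻ x in ball y 1, ‖u₀ x‖ₑ ^ 2 ≤ (α : ℝ≥0∞)) →
      Tendsto (fun y : ℝ³ => ∫⁻ x in ball y 1, ‖u₀ x‖ₑ ^ 2) (cocompact ℝ³) (𝓝 0) →
      ContDiffOn ℝ ∞ u₀ (ball x₀ 4) →
      (∀ n : ℕ, ∀ x ∈ ball x₀ 4, ‖iteratedFDeriv ℝ n u₀ x‖ ≤ A n) →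
      0 < T' → IsLocalLeraySolutionOn T' 1 u₀ u p →
      ∃ U : ℝ → ℝ³ → ℝ³,
        uncurry U =ᵐ[volume.restrict (Ioo 0 (min T T') ×ˢ ball x₀ (1 / 8))] uncurry u ∧
        ContinuousOn (uncurry U) (Icc 0 (min T T') ×ˢ ball x₀ (1 / 8)) ∧
        (∀ t ∈ Icc 0 (min T T'), ContDiffOn ℝ ∞ (U t) (ball x₀ (1 / 8))) ∧
        (∀ x ∈ ball x₀ (1 / 8), U 0 x = u₀ x) ∧
        (∀ n : ℕ, ∀ t ∈ Icc 0 (min T T'), ∀ x ∈ ball x₀ (1 / 8),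
          ‖iteratedFDeriv ℝ n (U t) x‖ ≤ C n) ∧
        ∀ n : ℕ, ∀ t ∈ Icc 0 (min T T'), ∀ s ∈ Icc 0 (min T T'), ∀ x ∈ ball x₀ (1 / 8),
          ‖iteratedFDeriv ℝ n (U t) x - iteratedFDeriv ℝ n (U s) x‖ ≤ C n * |t - s|

/-- **The §4 claim (general-data reading) in Jia–Šverák's global-in-time class `𝒩(u₀)`**: a
Leray solution on `ℝ³ × (0, ∞)` (`IsLocalLeraySolution 1 u₀ u p`, the class of the printed claim)
is the case `T' = T` of `jia_sverak_2014_local_higher_regularity`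
(`IsLocalLeraySolution.isLocalLeraySolutionOn`), with the conclusion on the printed cylinder
`B_{1/8}(x₀) × [0, T]`; the data remain general (`E²`, smooth on `B₄(x₀)`), see the module
docstring, note *General data*.
[cite: JiaSverak2014, §4 proof of Thm. 4.1 (claim for |x₀| = 8)] -/
theorem jia_sverak_2014_local_higher_regularity.of_isLocalLeraySolution
    (h : jia_sverak_2014_local_higher_regularity) (α : ℝ≥0) (A : ℕ → ℝ) :
    ∃ T : ℝ, 0 < T ∧ ∃ C : ℕ → ℝ,
      ∀ (u₀ : ℝ³ → ℝ³) (x₀ : ℝ³) (u : ℝ → ℝ³ → ℝ³) (p : ℝ → ℝ³ → ℝ),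
        AEStronglyMeasurable u₀ volume → IsWeaklyDivFree u₀ →
        (∀ y : ℝ³, ∫⁻ x in ball y 1, ‖u₀ x‖ₑ ^ 2 ≤ (α : ℝ≥0∞)) →
        Tendsto (fun y : ℝ³ => ∫⁻ x in ball y 1, ‖u₀ x‖ₑ ^ 2) (cocompact ℝ³) (𝓝 0) →
        ContDiffOn ℝ ∞ u₀ (ball x₀ 4) →
        (∀ n : ℕ, ∀ x ∈ ball x₀ 4, ‖iteratedFDeriv ℝ n u₀ x‖ ≤ A n) →
        IsLocalLeraySolution 1 u₀ u p →
        ∃ U : ℝ → ℝ³ → ℝ³,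
          uncurry U =ᵐ[volume.restrict (Ioo 0 T ×ˢ ball x₀ (1 / 8))] uncurry u ∧
          ContinuousOn (uncurry U) (Icc 0 T ×ˢ ball x₀ (1 / 8)) ∧
          (∀ t ∈ Icc 0 T, ContDiffOn ℝ ∞ (U t) (ball x₀ (1 / 8))) ∧
          (∀ x ∈ ball x₀ (1 / 8), U 0 x = u₀ x) ∧
          (∀ n : ℕ, ∀ t ∈ Icc 0 T, ∀ x ∈ ball x₀ (1 / 8), ‖iteratedFDeriv ℝ n (U t) x‖ ≤ C n) ∧
          ∀ n : ℕ, ∀ t ∈ Icc 0 T, ∀ s ∈ Icc 0 T, ∀ x ∈ ball x₀ (1 / 8),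
            ‖iteratedFDeriv ℝ n (U t) x - iteratedFDeriv ℝ n (U s) x‖ ≤ C n * |t - s| := by
  obtain ⟨T, hT, C, hC⟩ := h α A
  refine ⟨T, hT, C, fun u₀ x₀ u p hm hdiv hα hdec hs hA hu => ?_⟩
  simpa only [min_self] using
    hC u₀ x₀ T u p hm hdiv hα hdec hs hA hT (hu.isLocalLeraySolutionOn T)

/-! ### From the Lipschitz-in-time clause to pointwise time-derivative bounds -/

/-- **Reading `‖∂ₜ Dⁿ U‖ ≤ C n` off the Lipschitz clause** (how time-differentiable — e.g. classical
— solutions consume `jia_sverak_2014_local_higher_regularity`): if a curve `g : ℝ → F` is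
`L`-Lipschitz on an interval `I` (in the form `‖g t − g s‖ ≤ L |t − s|`) and has the one-sided /
two-sided derivative `g'` within `I` at a point `t ∈ I` which is a limit point of `I`, then
`‖g'‖ ≤ L`. [folklore] -/
theorem norm_le_of_hasDerivWithinAt_of_lipschitz_time {F : Type*} [NormedAddCommGroup F]
    [NormedSpace ℝ F] {g : ℝ → F} {g' : F} {I : Set ℝ} {L t : ℝ}
    (hL : ∀ s ∈ I, ∀ s' ∈ I, ‖g s - g s'‖ ≤ L * |s - s'|) (ht : t ∈ I)
    (hacc : (𝓝[I \ {t}] t).NeBot) (hg : HasDerivWithinAt g g' I t) : ‖g'‖ ≤ L := by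
  -- the difference quotients are bounded by `L` in norm and converge to `g'`
  have hq : Tendsto (slope g t) (𝓝[I \ {t}] t) (𝓝 g') := hasDerivWithinAt_iff_tendsto_slope.1 hg
  have hbound : ∀ᶠ s in 𝓝[I \ {t}] t, ‖slope g t s‖ ≤ L := by
    filter_upwards [self_mem_nhdsWithin] with s hs
    have hst : 0 < |s - t| := abs_pos.2 (sub_ne_zero.2 hs.2)
    rw [slope_def_module, norm_smul, norm_inv, Real.norm_eq_abs]
    calc |s - t|⁻¹ * ‖g s - g t‖ ≤ |s - t|⁻¹ * (L * |s - t|) :=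
          mul_le_mul_of_nonneg_left (hL s hs.1 t ht) (inv_nonneg.2 (abs_nonneg _))
      _ = L := by field_simp
  haveI := hacc
  exact le_of_tendsto hq.norm hbound

/-- **The interval case** of `norm_le_of_hasDerivWithinAt_of_lipschitz_time`: on a non-degenerate
closed interval `[a, b]` every point is a limit point, so an `L`-Lipschitz curve has all its
one-sided derivatives within `[a, b]` bounded by `L` in norm (in particular at the initial time
`t = a`). [folklore] -/
theorem norm_le_of_hasDerivWithinAt_Icc_of_lipschitz_time {F : Type*} [NormedAddCommGroup F]
    [NormedSpace ℝ F] {g : ℝ → F} {g' : F} {a b L t : ℝ} (hab : a < b)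
    (hL : ∀ s ∈ Icc a b, ∀ s' ∈ Icc a b, ‖g s - g s'‖ ≤ L * |s - s'|) (ht : t ∈ Icc a b)
    (hg : HasDerivWithinAt g g' (Icc a b) t) : ‖g'‖ ≤ L := by
  refine norm_le_of_hasDerivWithinAt_of_lipschitz_time hL ht ?_ hg
  rcases lt_or_eq_of_le ht.2 with htb | rfl
  · -- `t < b`: approach from the right inside `(t, b)`
    have hsub : Ioo t b ⊆ Icc a b \ {t} := fun s hs =>
      ⟨⟨ht.1.trans hs.1.le, hs.2.le⟩, fun h => hs.1.ne' h⟩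
    exact (left_nhdsWithin_Ioo_neBot htb).mono (nhdsWithin_mono _ hsub)
  · -- `t = b`: approach from the left inside `(a, b)`
    have hsub : Ioo a t ⊆ Icc a t \ {t} := fun s hs =>
      ⟨⟨hs.1.le, hs.2.le⟩, fun h => hs.2.ne h⟩
    exact (right_nhdsWithin_Ioo_neBot hab).mono (nhdsWithin_mono _ hsub)

end Literature.Analysis.FluidPDE

end
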